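import Literature.Computability.MetaComplexity.GapMINKTNWRecon
import Literature.Computability.Complexity.IndexAllBricks
import Literature.Computability.Complexity.IsqrtBrick
import Literature.Computability.Complexity.UnaryBricks
import HarnessLib

/-!
# The parameters of the Gap-MINKT decision procedure as `FP` string functions (incl. the prime of the design of lines)

Topic `Literature/Computability/MetaComplexity`. The deterministic part of the decision procedure behind
Hirahara's Cor. 4.23 (FOCS 2018 / ECCC TR18-138) in the tree's route through the design of lines
(`LineDesigns.lean`): from an instance `⟨x, ⟨1ᵗ, 1ˢ⟩⟩` of `Gap_{σ,τ}MINKT` the procedure computes, in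
polynomial time, the parameters of the Nisan–Wigderson generator it samples — the code parameter `e`, the
block length `ℓ = log₂ |enc(1ᵉ, x)|`, the PRIME `q = leastPrimeGe(2ℓ + 2⌊√s⌋ + R(n))` of the design (found by
trial division in unary — Bertrand's postulate bounds the search), the seed length `d = ℓ q`, the output
length `m = s + d + R(n)`, `R(n) = A(log₂ n + 1) + B` (proof of Cor. 4.12 with `s` known: "`d/ℓ := √K_t(x)` and
`m := K_t(x) + d + O(log n) + …`"), the doubly exponential ruler `T = 2^{2^J + J + 1}` with
`J = |bin |bin (t + N(n))||` (Lemma 4.19: the budget rounded to a power of two) and the oracle budget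
`t₁ = q_Y(T + P_Y(n))`:

* `NWPar.primeF` (`1^q ↦ [q prime]`, trial division with `Brick.allIdxFn`), `NWPar.lpgF`
  (`1^N ↦ 1^{leastPrimeGe N}`, counting the offsets before the first prime), with their values and `FP` membership;
* `NWPar.Cfg` — the Lean-level constants of the procedure — and the parameter maps `Cfg.eOf`, `Cfg.ellOf`,
  `Cfg.qOf`, `Cfg.dOf`, `Cfg.mOf`, `Cfg.VOf`, `Cfg.JOf`, `Cfg.TOf`, `Cfg.t1Of`;
* the string functions `nF, eF, fF, lF, sqF, NqF, qF, dF, mF, VF, L1F, JF, bigRF, twoJF, EF, TF, t1F` on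
  instances `inst x t s = ⟨x, ⟨1ᵗ, 1ˢ⟩⟩`, each with its value (`…_inst`) and `FP` membership (`…_mem_FP`).

## References

* S. Hirahara, ECCC TR18-138 (2018), proof of Cor. 4.12 (p. 19), Lemma 4.19, proof of Thm. 4.21, Cor. 4.23.
* S. Arora, B. Barak, *Computational Complexity: A Modern Approach*, CUP 2009, §1.3 (bounded loops).
* P. L. Chebyshev / Bertrand's postulate (Mathlib `Nat.exists_prime_lt_and_le_two_mul`).
-/

noncomputable section

namespace Literature.Computability.MetaComplexity

open _root_.Computability Polynomial Complexity Complexity.Brick Complexity.Plumb Complexity.OracleCompose Complexity.HashBricks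

namespace NWPar

/-! ### Primality by trial division, in unary -/

/-- `[2 ≤ |u|]`. [folklore] -/
def geTwoF : List Bool → List Bool := notFn (isNilFn ∘ dropFn ∘ fanoutFn (fun _ => ones 1) id)

/-- Value of `geTwoF`. [folklore] -/
theorem geTwoF_apply (u : List Bool) : geTwoF u = [decide (2 ≤ u.length)] := by
  have h : (isNilFn ∘ dropFn ∘ fanoutFn (fun _ => ones 1) id) u = [decide (u.drop 1 = [])] := by
    simp [isNilFn, ones]
  rw [geTwoF, notFn_apply h]
  congr 1
  rcases u with _ | ⟨a, _ | ⟨b, u⟩⟩ <;> simp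

/-- `geTwoF ∈ FP`. [folklore] -/
theorem geTwoF_mem_FP : geTwoF ∈ FP :=
  notFn_mem_FP (comp_mem_FP isNilFn_mem_FP (comp_mem_FP dropFn_mem_FP (fanoutFn_mem_FP (const_mem_FP _) (PolyTimeComputable.id _))))

/-- The trial-division test `⟨1^q, 1^d⟩ ↦ [¬(2 ≤ d ∧ d ∣ q)]`. [folklore] -/
def noDivF : List Bool → List Bool := notFn (andFn (geTwoF ∘ sndF) (isNilFn ∘ sndF ∘ divModFn ∘ fanoutFn sndF fstF))

/-- Value of `noDivF`. [folklore] -/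
theorem noDivF_apply (q d : ℕ) : noDivF (boolPair (ones q) (ones d)) = [decide ¬(2 ≤ d ∧ d ∣ q)] := by
  have h1 : (geTwoF ∘ sndF) (boolPair (ones q) (ones d)) = [decide (2 ≤ d)] := by simp [geTwoF_apply, ones]
  have h2 : (isNilFn ∘ sndF ∘ divModFn ∘ fanoutFn sndF fstF) (boolPair (ones q) (ones d)) = [decide (d ∣ q)] := by
    simp only [Function.comp_apply, fanoutFn_apply, sndF_boolPair, fstF_boolPair, divModFn_boolPair, isNilFn]
    congr 1
    rw [decide_eq_decide, ones, List.replicate_eq_nil_iff, Nat.dvd_iff_mod_eq_zero]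
  rw [noDivF, notFn_apply (andFn_apply h1 h2)]
  congr 1
  by_cases ha : 2 ≤ d <;> by_cases hb : d ∣ q <;> simp [ha, hb]

/-- `noDivF ∈ FP`. [folklore] -/
theorem noDivF_mem_FP : noDivF ∈ FP :=
  notFn_mem_FP (andFn_mem_FP (comp_mem_FP geTwoF_mem_FP sndF_mem_FP)
    (comp_mem_FP isNilFn_mem_FP (comp_mem_FP sndF_mem_FP (comp_mem_FP divModFn_mem_FP (fanoutFn_mem_FP sndF_mem_FP fstF_mem_FP)))))

/-- `noDivF` is one-bit. [folklore] -/
theorem oneBit_noDivF : OneBit noDivF := oneBit_notFn (oneBit_andFn (fun u => ⟨_, geTwoF_apply (sndF u)⟩) (oneBit_isNilFn.comp _))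

/-- **Primality in unary**: `1^q ↦ [q prime]` (`2 ≤ q` and no divisor `2 ≤ d < q`).
[cite: AroraBarak2009, §1.3 (bounded loops)] -/
def primeF : List Bool → List Bool := andFn geTwoF (allIdxFn id noDivF)

/-- Value of `primeF`. [folklore] -/
theorem primeF_apply (q : ℕ) : primeF (ones q) = [decide q.Prime] := by
  have hall : allIdxFn id noDivF (ones q) = [decide (∀ d < q, ¬(2 ≤ d ∧ d ∣ q))] := by
    rw [allIdxFn_apply (h := id) oneBit_noDivF (u := ones q) le_rfl]
    simp only [id, List.length_replicate]
    congr 1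
    rw [decide_eq_decide]
    refine forall₂_congr fun d _ => ?_
    rw [noDivF_apply, List.cons.injEq]
    simp only [decide_eq_true_eq, and_true, not_and]
  rw [primeF, andFn_apply (geTwoF_apply _) hall]
  simp only [List.length_replicate]
  congr 1
  rw [← Bool.decide_and, decide_eq_decide, Nat.prime_def_lt]
  constructor
  · rintro ⟨h2, h⟩
    refine ⟨h2, fun d hd hdvd => ?_⟩
    by_contra hne
    rcases Nat.lt_or_ge d 2 with hlt | hge
    · interval_cases d
      · exact absurd (Nat.eq_zero_of_zero_dvd hdvd) (by omega)
      · exact hne rfl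
    · exact h d hd ⟨hge, hdvd⟩
  · rintro ⟨h2, h⟩
    exact ⟨h2, fun d hd ⟨hd2, hdvd⟩ => by have := h d hd hdvd; omega⟩

/-- `primeF ∈ FP`. [folklore] -/
theorem primeF_mem_FP : primeF ∈ FP :=
  andFn_mem_FP geTwoF_mem_FP (allIdxFn_mem_FP (PolyTimeComputable.id _) noDivF_mem_FP oneBit_noDivF)

/-- `primeF` is one-bit. [folklore] -/
theorem oneBit_primeF : OneBit primeF :=
  oneBit_andFn (fun u => ⟨_, geTwoF_apply u⟩) (oneBit_allIdxFn oneBit_noDivF fun _ => le_rfl)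

/-! ### The least prime `≥ N` -/

/-- "No prime among `N, …, N + k`", on `⟨⟨1^N, pad⟩, 1^k⟩`. [folklore] -/
def noPrimeUpToF : List Bool → List Bool :=
  allIdxFn (fun w => sndF w ++ [true]) (notFn (primeF ∘ fun v => (fstF ∘ fstF ∘ fstF) v ++ sndF v))

/-- Value of `noPrimeUpToF` (`|pad| + N ≥ 0` suffices: the yardstick `k + 1 ≤ |⟨⟨1^N, pad⟩, 1^k⟩|`). [folklore] -/
theorem noPrimeUpToF_apply (N k : ℕ) (pad : List Bool) :
    noPrimeUpToF (boolPair (boolPair (ones N) pad) (ones k)) = [decide (∀ k' ≤ k, ¬(N + k').Prime)] := by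
  have hone : OneBit (notFn (primeF ∘ fun v => (fstF ∘ fstF ∘ fstF) v ++ sndF v)) := oneBit_notFn (oneBit_primeF.comp _)
  rw [noPrimeUpToF, allIdxFn_apply hone (by simp only [sndF_boolPair, List.length_append, List.length_singleton, length_boolPair]; omega)]
  simp only [sndF_boolPair, List.length_append, List.length_replicate, List.length_singleton]
  congr 1
  rw [decide_eq_decide]
  have hval : ∀ k', notFn (primeF ∘ fun v => (fstF ∘ fstF ∘ fstF) v ++ sndF v)
      (boolPair (boolPair (boolPair (ones N) pad) (ones k)) (ones k')) = [!decide (N + k').Prime] := fun k' => by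
    rw [notFn_apply (b := decide (N + k').Prime)]
    simp only [Function.comp_apply, fstF_boolPair, sndF_boolPair]
    rw [show ones N ++ ones k' = ones (N + k') by simp [ones], primeF_apply]
  simp only [hval, List.cons.injEq, and_true, Bool.not_eq_true', decide_eq_false_iff_not, Nat.lt_succ_iff]

/-- `noPrimeUpToF ∈ FP`. [folklore] -/
theorem noPrimeUpToF_mem_FP : noPrimeUpToF ∈ FP :=
  allIdxFn_mem_FP (append_mem_FP sndF_mem_FP (const_mem_FP _))
    (notFn_mem_FP (comp_mem_FP primeF_mem_FP (append_mem_FP (comp_mem_FP fstF_mem_FP (comp_mem_FP fstF_mem_FP fstF_mem_FP)) sndF_mem_FP)))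
    (oneBit_notFn (oneBit_primeF.comp _))

/-- The unary indicator piece of the offset count. [folklore] -/
def offPieceF : List Bool → List Bool := iteFn noPrimeUpToF (fun _ => [true]) (fun _ => [])

/-- Value of `offPieceF`. [folklore] -/
theorem offPieceF_apply (N k : ℕ) (pad : List Bool) :
    offPieceF (boolPair (boolPair (ones N) pad) (ones k)) = if ∀ k' ≤ k, ¬(N + k').Prime then [true] else [] := by
  rw [offPieceF, iteFn_apply (noPrimeUpToF_apply N k pad)]
  by_cases h : ∀ k' ≤ k, ¬(N + k').Prime
  · rw [decide_eq_true h, if_pos h]; rfl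
  · rw [decide_eq_false h, if_neg h]; rfl

/-- `offPieceF ∈ FP`. [folklore] -/
theorem offPieceF_mem_FP : offPieceF ∈ FP := iteFn_mem_FP noPrimeUpToF_mem_FP (const_mem_FP _) (const_mem_FP _)

/-- **The offset of the least prime `≥ N`**: the number of `k < N + 3` with no prime in `N, …, N + k`.
[folklore] -/
def lpgOffF : List Bool → List Bool := runFold appF (pclipF 1 offPieceF) (fanoutFn id fun _ => ones 3) (fun u => u ++ ones 3)

/-- The offsets before the least prime `≥ N` are exactly those below it. [folklore] -/
theorem forall_not_prime_iff (N k : ℕ) : (∀ k' ≤ k, ¬(N + k').Prime) ↔ N + k < leastPrimeGe N := by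
  constructor
  · intro h
    by_contra hle
    push Not at hle
    obtain ⟨hN, hp⟩ := leastPrimeGe_spec N
    exact h (leastPrimeGe N - N) (by omega) (by rw [Nat.add_sub_cancel' hN]; exact hp)
  · intro h k' hk' hp
    have hmin := Nat.find_min (Nat.exists_infinite_primes N) (m := N + k') (by unfold leastPrimeGe at h; omega)
    exact hmin ⟨Nat.le_add_right _ _, hp⟩

/-- `leastPrimeGe N ≤ 2N + 2` (Bertrand's postulate; `N = 0`: the prime `2`). [folklore] -/
theorem leastPrimeGe_le_two_mul_add_two (N : ℕ) : leastPrimeGe N ≤ 2 * N + 2 := by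
  rcases Nat.eq_zero_or_pos N with rfl | hN
  · have h2 : leastPrimeGe 0 ≤ 2 := Nat.find_min' _ ⟨Nat.zero_le _, Nat.prime_two⟩
    omega
  · exact (leastPrimeGe_le N hN.ne').trans (by omega)

/-- Value of `lpgOffF`: `1^{leastPrimeGe N − N}`. [folklore] -/
theorem lpgOffF_apply (N : ℕ) : lpgOffF (ones N) = ones (leastPrimeGe N - N) := by
  have hlen : ((fun u => u ++ ones 3) (ones N)).length ≤ (fanoutFn id (fun _ => ones 3) (ones N)).length := by
    simp only [fanoutFn_apply, id, length_boolPair, List.length_append, List.length_replicate]; omega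
  have hcnt : ((fun u => u ++ ones 3) (ones N)).length = N + 3 := by simp only [List.length_append, List.length_replicate]
  rw [lpgOffF, runFold_apply appF (pclipF 1 offPieceF) (fanoutFn id fun _ => ones 3) (fun u => u ++ ones 3) (w := ones N) hlen, hcnt,
    fanoutFn_apply, id, foldAcc_pclipF (fun k _ _ => by rw [offPieceF_apply]; split_ifs <;> simp), foldAcc_appF, List.nil_append]
  rw [ccat_congr (g' := fun k => ones (if N + k < leastPrimeGe N then 1 else 0)) (fun k _ => by
      rw [Nat.zero_add, offPieceF_apply]
      by_cases h : N + k < leastPrimeGe N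
      · rw [if_pos ((forall_not_prime_iff N k).2 h), if_pos h]; rfl
      · rw [if_neg (fun h' => h ((forall_not_prime_iff N k).1 h')), if_neg h]; rfl),
    NWRec.ccat_ones]
  congr 1
  have hN := (leastPrimeGe_spec N).1
  have hle := leastPrimeGe_le_two_mul_add_two N
  rw [Finset.sum_ite, Finset.sum_const_zero, add_zero, Finset.sum_const, smul_eq_mul, mul_one,
    show (Finset.range (N + 3)).filter (fun k => N + k < leastPrimeGe N) = Finset.range (leastPrimeGe N - N) by
      ext k; simp only [Finset.mem_filter, Finset.mem_range]; omega]
  exact Finset.card_range _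

/-- `lpgOffF ∈ FP`. [folklore] -/
theorem lpgOffF_mem_FP : lpgOffF ∈ FP :=
  runFold_mem_FP appF_mem_FP (X + 0) (fun w => by simpa using length_appF_le w) (pclipF_mem_FP 1 offPieceF_mem_FP) 1
    (length_pclipF_le 1 offPieceF) (fanoutFn_mem_FP (PolyTimeComputable.id _) (const_mem_FP _)) (append_mem_FP (PolyTimeComputable.id _) (const_mem_FP _))

/-- **The least prime `≥ N` in unary**: `1^N ↦ 1^{leastPrimeGe N}`. [folklore] -/
def lpgF : List Bool → List Bool := fun u => id u ++ lpgOffF u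

/-- Value of `lpgF`. [folklore] -/
theorem lpgF_apply (N : ℕ) : lpgF (ones N) = ones (leastPrimeGe N) := by
  rw [lpgF, id, lpgOffF_apply]
  simp only [ones, List.replicate_append_replicate, Nat.add_sub_cancel' (leastPrimeGe_spec N).1]

/-- `lpgF ∈ FP`. [folklore] -/
theorem lpgF_mem_FP : lpgF ∈ FP := append_mem_FP (PolyTimeComputable.id _) lpgOffF_mem_FP

/-! ### The constants of the procedure and the parameter maps -/

/-- **The Lean-level constants of the decision procedure**: the encoder `enc` of the code, the code
parameter polynomial `Pe` (`e = Pe(n)`), the domination polynomial `Nbig` (`V = t + Nbig(n)`), the ruler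
polynomial `Rpoly` (room for `T ≤ Rpoly(V)`), the budget polynomials `qY, PY` (`t₁ = qY(T + PY(n))`), and the
constants `A, B` of the slack `R(n) = A(log₂ n + 1) + B` shared by the prime and the output length. [cite: Hirahara2018, Cor. 4.12 (proof), Thm. 4.21 (proof)] -/
structure Cfg where
  /-- The encoder of the list-decodable code (`⟨1ᵉ, x⟩ ↦ Enc_{n,1/e}(x)`). -/
  enc : List Bool → List Bool
  /-- `e = Pe(n)`. -/
  Pe : Polynomial ℕ
  /-- The slack `R(n) = A (log₂ n + 1) + B`. -/
  A : ℕ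
  /-- The slack `R(n) = A (log₂ n + 1) + B`. -/
  B : ℕ
  /-- `V = t + Nbig(n)`. -/
  Nbig : Polynomial ℕ
  /-- The ruler for the powers of two: `1^{Rpoly(V)}`. -/
  Rpoly : Polynomial ℕ
  /-- `t₁ = qY(T + PY(n))`. -/
  qY : Polynomial ℕ
  /-- `t₁ = qY(T + PY(n))`. -/
  PY : Polynomial ℕ

namespace Cfg

variable (c : Cfg)

/-- `e = Pe(n)`. [cite: Hirahara2018, Thm. 4.7 (`ε⁻¹`)] -/
def eOf (n : ℕ) : ℕ := c.Pe.eval n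
/-- `f = enc(1ᵉ, x)`. [cite: Hirahara2018, Lemma 4.9 ("`f := Enc_{n,δ}(x)`")] -/
def fOf (x : List Bool) : List Bool := c.enc (boolPair (ones (c.eOf x.length)) x)
/-- `ℓ = log₂ |f|`. [cite: Hirahara2018, Lemma 4.9 ("`2^ℓ := |Enc_{n,δ}(x)|`")] -/
def ellOf (x : List Bool) : ℕ := Nat.log 2 (c.fOf x).length
/-- **The slack** `R(n) = A(log₂ n + 1) + B`. [cite: Hirahara2018, Cor. 4.12 (proof: "`m := K_t(x) + d + O(log n) + …`")] -/
def ROf (n : ℕ) : ℕ := c.A * (Nat.log 2 n + 1) + c.B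
/-- `N_q = 2ℓ + 2⌊√s⌋ + R(n)`. [cite: Hirahara2018, Cor. 4.12 (proof: "`d/ℓ := √K_t(x)`")] -/
def NqOf (x : List Bool) (s : ℕ) : ℕ := 2 * c.ellOf x + 2 * Nat.sqrt s + c.ROf x.length
/-- **The prime of the design**: `q = leastPrimeGe N_q`. [cite: NisanWigderson1994, Lemma 2.5] -/
def qOf (x : List Bool) (s : ℕ) : ℕ := leastPrimeGe (c.NqOf x s)
/-- The seed length `d = ℓ q`. [cite: Hirahara2018, Lemma 4.4 (`d`)] -/
def dOf (x : List Bool) (s : ℕ) : ℕ := c.ellOf x * c.qOf x s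
/-- **The output length** `m = s + d + R(n)`. [cite: Hirahara2018, Cor. 4.12 (proof: "`m := K_t(x) + d + O(log n) + …`")] -/
def mOf (x : List Bool) (s : ℕ) : ℕ := s + c.dOf x s + c.ROf x.length
/-- `V = t + Nbig(n)` (dominates the budget and every numeral). [cite: Hirahara2018, Lemma 4.19] -/
def VOf (n t : ℕ) : ℕ := t + c.Nbig.eval n
/-- `J = |bin |bin V||` (so that `2^{2^J} > V`). [cite: Hirahara2018, Lemma 4.19 ("`t₁` is a power of `2`")] -/
def JOf (n t : ℕ) : ℕ := (encodeNat (encodeNat (c.VOf n t)).length).length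
/-- **The ruler** `T = 2^{2^J + J + 1}` (`= NWOut.rulerLen (1^J)`). [cite: Hirahara2018, Lemma 4.19] -/
def TOf (n t : ℕ) : ℕ := 2 ^ (2 ^ c.JOf n t + c.JOf n t + 1)
/-- **The oracle budget** `t₁ = qY(T + PY(n))`. [cite: Hirahara2018, Thm. 4.21 (proof: "`t₁ ≥ t + poly(n)`")] -/
def t1Of (n t : ℕ) : ℕ := c.qY.eval (c.TOf n t + c.PY.eval n)

/-- `T = rulerLen (1^J)`. [folklore] -/
theorem TOf_eq_rulerLen (n t : ℕ) : c.TOf n t = NWOut.rulerLen (ones (c.JOf n t)) := by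
  simp [TOf, NWOut.rulerLen, ones]

/-- `V < 2^{|bin V|}`. [folklore] -/
theorem lt_two_pow_length_encodeNat (v : ℕ) : v < 2 ^ (encodeNat v).length := by
  have := bitsToNat_lt (encodeNat v)
  rwa [bitsToNat_encodeNat] at this

/-- **The ruler exceeds `V`**: `V < T`. [cite: Hirahara2018, Lemma 4.19] -/
theorem VOf_lt_TOf (n t : ℕ) : c.VOf n t < c.TOf n t := by
  have h1 := lt_two_pow_length_encodeNat (c.VOf n t)
  have h2 := lt_two_pow_length_encodeNat (encodeNat (c.VOf n t)).length
  rw [TOf, JOf]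
  calc c.VOf n t < 2 ^ (encodeNat (c.VOf n t)).length := h1
    _ ≤ 2 ^ (2 ^ (encodeNat (encodeNat (c.VOf n t)).length).length + (encodeNat (encodeNat (c.VOf n t)).length).length + 1) :=
        Nat.pow_le_pow_right (by norm_num) (by omega)

/-- `2^{|bin v|} ≤ 2v + 2` (cf. `two_pow_length_encodeNat_le` in `FineGrained/NSETHMachineModel.lean`, `≤ 2m + 1`, not
imported: unrelated heavy closure). [folklore] -/
theorem two_pow_length_encodeNat_le (v : ℕ) : 2 ^ (encodeNat v).length ≤ 2 * v + 2 := by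
  rcases Nat.eq_zero_or_pos v with rfl | hv
  · simp [encodeNat, encodeNum]
  · have h := TM2Pass.length_encodeNat_le v
    calc 2 ^ (encodeNat v).length ≤ 2 ^ (Nat.log 2 v + 1) := Nat.pow_le_pow_right (by norm_num) h
      _ = 2 * 2 ^ Nat.log 2 v := by rw [pow_succ, mul_comm]
      _ ≤ 2 * v := Nat.mul_le_mul_left 2 (Nat.pow_log_le_self 2 hv.ne')
      _ ≤ 2 * v + 2 := Nat.le_add_right _ _

/-- **The ruler is polynomial in `V`**: `T ≤ 8 (2V + 2)² (4V + 6)`. [folklore] -/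
theorem TOf_le (n t : ℕ) : c.TOf n t ≤ 8 * (2 * c.VOf n t + 2) ^ 2 * (4 * c.VOf n t + 6) := by
  set V := c.VOf n t
  set L₁ := (encodeNat V).length
  set J := (encodeNat L₁).length
  have hJ : 2 ^ J ≤ 2 * L₁ + 2 := two_pow_length_encodeNat_le L₁
  have hL : 2 ^ L₁ ≤ 2 * V + 2 := two_pow_length_encodeNat_le V
  have hL1 : L₁ ≤ 2 * V + 2 := (Nat.lt_two_pow_self).le.trans hL
  have hT : c.TOf n t = 2 ^ 2 ^ J * 2 ^ J * 2 := by rw [TOf, JOf, pow_add, pow_add, pow_one]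
  rw [hT]
  calc 2 ^ 2 ^ J * 2 ^ J * 2 ≤ 2 ^ (2 * L₁ + 2) * (2 * L₁ + 2) * 2 :=
        Nat.mul_le_mul_right 2 (Nat.mul_le_mul (Nat.pow_le_pow_right (by norm_num) hJ) hJ)
    _ = (2 ^ L₁) ^ 2 * 4 * (2 * L₁ + 2) * 2 := by rw [pow_add, pow_mul']; ring
    _ ≤ (2 * V + 2) ^ 2 * 4 * (2 * (2 * V + 2) + 2) * 2 := by gcongr
    _ = 8 * (2 * V + 2) ^ 2 * (4 * V + 6) := by ring

/-- `2^J ≤ T`. [folklore] -/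
theorem two_pow_JOf_le_TOf (n t : ℕ) : 2 ^ c.JOf n t ≤ c.TOf n t :=
  Nat.pow_le_pow_right (by norm_num) (by have := @Nat.lt_two_pow_self (c.JOf n t); omega)

end Cfg

/-! ### The parameter bricks on instances `⟨x, ⟨1ᵗ, 1ˢ⟩⟩` -/

/-- The instance `⟨x, ⟨1ᵗ, 1ˢ⟩⟩` of `Gap_{σ,τ}MINKT`. [cite: Hirahara2018, Def. 3.6] -/
def inst (x : List Bool) (t s : ℕ) : List Bool := boolPair x (boolPair (ones t) (ones s))

/-- `inst` is the encoding of `U.gapMINKT`'s instances. [folklore] -/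
theorem inst_eq (x : List Bool) (t s : ℕ) : inst x t s = boolPair x (boolPair (unaryEncodeNat t) (unaryEncodeNat s)) := by
  rw [inst, Complexity.unaryEncodeNat_eq_replicate, Complexity.unaryEncodeNat_eq_replicate]

/-- `1ᵗ`. [folklore] -/
def TT : List Bool → List Bool := fstF ∘ sndF
/-- `1ˢ`. [folklore] -/
def SS : List Bool → List Bool := sndF ∘ sndF
/-- `1ⁿ`, `n = |x|`. [folklore] -/
def nF : List Bool → List Bool := onesFn ∘ fstF

/-- The projection `TT` evaluated on an instance `⟨x, 1ᵗ, 1ˢ⟩`. [folklore] -/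
@[simp] theorem TT_inst (x : List Bool) (t s : ℕ) : TT (inst x t s) = ones t := by simp [TT, inst]
/-- The projection `SS` evaluated on an instance `⟨x, 1ᵗ, 1ˢ⟩`. [folklore] -/
@[simp] theorem SS_inst (x : List Bool) (t s : ℕ) : SS (inst x t s) = ones s := by simp [SS, inst]
/-- The projection `nF` evaluated on an instance `⟨x, 1ᵗ, 1ˢ⟩`. [folklore] -/
@[simp] theorem nF_inst (x : List Bool) (t s : ℕ) : nF (inst x t s) = ones x.length := by
  simp [nF, inst, onesFn, Complexity.unaryEncodeNat_eq_replicate, ones]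
/-- The projection `fstF` evaluated on an instance `⟨x, 1ᵗ, 1ˢ⟩`. [folklore] -/
@[simp] theorem fstF_inst (x : List Bool) (t s : ℕ) : fstF (inst x t s) = x := by simp [inst]

/-- `TT` is polynomial-time computable (`FP`). [folklore] -/
theorem TT_mem_FP : TT ∈ FP := comp_mem_FP fstF_mem_FP sndF_mem_FP
/-- `SS` is polynomial-time computable (`FP`). [folklore] -/
theorem SS_mem_FP : SS ∈ FP := comp_mem_FP sndF_mem_FP sndF_mem_FP
/-- `nF` is polynomial-time computable (`FP`). [folklore] -/
theorem nF_mem_FP : nF ∈ FP := comp_mem_FP onesFn_mem_FP fstF_mem_FP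

namespace Cfg

variable (c : Cfg)

/-- `1ᵉ`. [folklore] -/
def eF : List Bool → List Bool := polyFn c.Pe ∘ nF
/-- `f = enc(1ᵉ, x)`. [folklore] -/
def fF : List Bool → List Bool := c.enc ∘ fanoutFn c.eF fstF
/-- `1^ℓ`. [folklore] -/
def lF : List Bool → List Bool := logFn ∘ c.fF
/-- `1^{⌊√s⌋}`. [folklore] -/
def sqF : List Bool → List Bool := binToUnaryFn ∘ fanoutFn SS (isqrtFn ∘ SS)
/-- `1^{R(n)}`. [folklore] -/
def RF : List Bool → List Bool := polyFn (C c.A * X + C (c.A + c.B)) ∘ logFn ∘ nF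
/-- `1^{N_q}`. [folklore] -/
def NqF : List Bool → List Bool := fun w => (fun w => c.lF w ++ c.lF w) w ++ (fun w => (fun w => sqF w ++ sqF w) w ++ c.RF w) w
/-- `1^q`. [folklore] -/
def qF : List Bool → List Bool := lpgF ∘ c.NqF
/-- `1^d`. [folklore] -/
def dF : List Bool → List Bool := umulFn ∘ fanoutFn c.lF c.qF
/-- `1^m`. [folklore] -/
def mF : List Bool → List Bool := fun w => SS w ++ (fun w => c.dF w ++ c.RF w) w
/-- `1^V`. [folklore] -/
def VF : List Bool → List Bool := fun w => TT w ++ (polyFn c.Nbig ∘ nF) w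
/-- `1^J`. [folklore] -/
def JF : List Bool → List Bool := onesFn ∘ lenBinF ∘ onesFn ∘ lenBinF ∘ c.VF
/-- The auxiliary ruler `1^{Rpoly(V)}`. [folklore] -/
def bigRF : List Bool → List Bool := polyFn c.Rpoly ∘ c.VF
/-- `1^{2^J}`. [folklore] -/
def twoJF : List Bool → List Bool := NWRec.pow2F ∘ fanoutFn c.bigRF c.JF
/-- A string of length `2^J + J + 1`. [folklore] -/
def EF : List Bool → List Bool := fun w => c.twoJF w ++ (fun w => c.JF w ++ (fun _ => [true]) w) w
/-- `1^T`. [folklore] -/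
def TF : List Bool → List Bool := NWRec.pow2F ∘ fanoutFn c.bigRF c.EF
/-- `1^{t₁}`. [folklore] -/
def t1F : List Bool → List Bool := polyFn c.qY ∘ fun w => c.TF w ++ (polyFn c.PY ∘ nF) w

section Values

variable (x : List Bool) (t s : ℕ)

/-- The projection `eF` evaluated on an instance `⟨x, 1ᵗ, 1ˢ⟩`. [folklore] -/
theorem eF_inst : c.eF (inst x t s) = ones (c.eOf x.length) := by
  simp only [eF, Function.comp_apply, nF_inst, polyFn_apply, List.length_replicate, eOf]
/-- The projection `fF` evaluated on an instance `⟨x, 1ᵗ, 1ˢ⟩`. [folklore] -/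
theorem fF_inst : c.fF (inst x t s) = c.fOf x := by
  simp only [fF, Function.comp_apply, fanoutFn_apply, eF_inst, fstF_inst, fOf]
/-- The projection `lF` evaluated on an instance `⟨x, 1ᵗ, 1ˢ⟩`. [folklore] -/
theorem lF_inst : c.lF (inst x t s) = ones (c.ellOf x) := by
  simp only [lF, Function.comp_apply, fF_inst, logFn, ellOf]
/-- The projection `sqF` evaluated on an instance `⟨x, 1ᵗ, 1ˢ⟩`. [folklore] -/
theorem sqF_inst : sqF (inst x t s) = ones (Nat.sqrt s) := by
  simp only [sqF, Function.comp_apply, fanoutFn_apply, SS_inst, isqrtFn_apply, List.length_replicate, binToUnaryFn_boolPair, bitsToNat_encodeNat,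
    min_eq_left (Nat.sqrt_le_self s)]
/-- The projection `RF` evaluated on an instance `⟨x, 1ᵗ, 1ˢ⟩`. [folklore] -/
theorem RF_inst : c.RF (inst x t s) = ones (c.ROf x.length) := by
  simp only [RF, Function.comp_apply, nF_inst, logFn, List.length_replicate, polyFn_apply, eval_add, eval_mul, eval_C, eval_X, ROf]
  congr 1; ring
/-- The projection `NqF` evaluated on an instance `⟨x, 1ᵗ, 1ˢ⟩`. [folklore] -/
theorem NqF_inst : c.NqF (inst x t s) = ones (c.NqOf x s) := by
  simp only [NqF, lF_inst, sqF_inst, RF_inst, NqOf, ones, List.replicate_append_replicate]; congr 1; ring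
/-- The projection `qF` evaluated on an instance `⟨x, 1ᵗ, 1ˢ⟩`. [folklore] -/
theorem qF_inst : c.qF (inst x t s) = ones (c.qOf x s) := by
  simp only [qF, Function.comp_apply, NqF_inst, lpgF_apply, qOf]
/-- The projection `dF` evaluated on an instance `⟨x, 1ᵗ, 1ˢ⟩`. [folklore] -/
theorem dF_inst : c.dF (inst x t s) = ones (c.dOf x s) := by
  simp only [dF, Function.comp_apply, fanoutFn_apply, lF_inst, qF_inst, umulFn_boolPair, dOf]
/-- The projection `mF` evaluated on an instance `⟨x, 1ᵗ, 1ˢ⟩`. [folklore] -/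
theorem mF_inst : c.mF (inst x t s) = ones (c.mOf x s) := by
  simp only [mF, SS_inst, dF_inst, RF_inst, mOf, ones, List.replicate_append_replicate, Nat.add_assoc]
/-- The projection `VF` evaluated on an instance `⟨x, 1ᵗ, 1ˢ⟩`. [folklore] -/
theorem VF_inst : c.VF (inst x t s) = ones (c.VOf x.length t) := by
  simp only [VF, TT_inst, Function.comp_apply, nF_inst, polyFn_apply, List.length_replicate, VOf, ones, List.replicate_append_replicate]
/-- The projection `JF` evaluated on an instance `⟨x, 1ᵗ, 1ˢ⟩`. [folklore] -/
theorem JF_inst : c.JF (inst x t s) = ones (c.JOf x.length t) := by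
  simp only [JF, Function.comp_apply, VF_inst, lenBinF_apply, List.length_replicate, onesFn, Complexity.unaryEncodeNat_eq_replicate, JOf, ones]
/-- The projection `bigRF` evaluated on an instance `⟨x, 1ᵗ, 1ˢ⟩`. [folklore] -/
theorem bigRF_inst : c.bigRF (inst x t s) = ones (c.Rpoly.eval (c.VOf x.length t)) := by
  simp only [bigRF, Function.comp_apply, VF_inst, polyFn_apply, List.length_replicate]

variable {x t s}

/-- `twoJF` on an instance is `1^{2^J}` (given the domination hypothesis `T ≤ Rpoly(V)`). [folklore] -/
theorem twoJF_inst (hR : c.TOf x.length t ≤ c.Rpoly.eval (c.VOf x.length t)) : c.twoJF (inst x t s) = ones (2 ^ c.JOf x.length t) := by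
  simp only [twoJF, Function.comp_apply, fanoutFn_apply, bigRF_inst, JF_inst, NWRec.pow2F_apply, List.length_replicate,
    min_eq_left ((c.two_pow_JOf_le_TOf x.length t).trans hR)]
/-- The length of the exponent field `EF` on an instance. [folklore] -/
theorem length_EF_inst (hR : c.TOf x.length t ≤ c.Rpoly.eval (c.VOf x.length t)) :
    (c.EF (inst x t s)).length = 2 ^ c.JOf x.length t + c.JOf x.length t + 1 := by
  simp only [EF, c.twoJF_inst hR, JF_inst, List.length_append, List.length_replicate, List.length_singleton, Nat.add_assoc]
/-- **The ruler `1^T` is computed** (given room `T ≤ Rpoly(V)`). [cite: Hirahara2018, Lemma 4.19] -/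
theorem TF_inst (hR : c.TOf x.length t ≤ c.Rpoly.eval (c.VOf x.length t)) : c.TF (inst x t s) = ones (c.TOf x.length t) := by
  simp only [TF, Function.comp_apply, fanoutFn_apply, bigRF_inst, NWRec.pow2F_apply, c.length_EF_inst hR]
  rw [show 2 ^ (2 ^ c.JOf x.length t + c.JOf x.length t + 1) = c.TOf x.length t from rfl, min_eq_left hR]
/-- **The budget `1^{t₁}` is computed.** [cite: Hirahara2018, Thm. 4.21 (proof)] -/
theorem t1F_inst (hR : c.TOf x.length t ≤ c.Rpoly.eval (c.VOf x.length t)) : c.t1F (inst x t s) = ones (c.t1Of x.length t) := by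
  simp only [t1F, Function.comp_apply, c.TF_inst hR, nF_inst, polyFn_apply, List.length_replicate, List.length_append, t1Of]

end Values

/-! #### `FP` membership -/

variable {c}

/-- `eF` is polynomial-time computable (`FP`). [folklore] -/
theorem eF_mem_FP : c.eF ∈ FP := comp_mem_FP (polyFn_mem_FP _) nF_mem_FP
/-- `fF` is polynomial-time computable (`FP`). [folklore] -/
theorem fF_mem_FP (henc : c.enc ∈ FP) : c.fF ∈ FP := comp_mem_FP henc (fanoutFn_mem_FP eF_mem_FP fstF_mem_FP)
/-- `lF` is polynomial-time computable (`FP`). [folklore] -/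
theorem lF_mem_FP (henc : c.enc ∈ FP) : c.lF ∈ FP := comp_mem_FP logFn_mem_FP (fF_mem_FP henc)
/-- `sqF` is polynomial-time computable (`FP`). [folklore] -/
theorem sqF_mem_FP : sqF ∈ FP := comp_mem_FP binToUnaryFn_mem_FP (fanoutFn_mem_FP SS_mem_FP (comp_mem_FP isqrtFn_mem_FP SS_mem_FP))
/-- `RF` is polynomial-time computable (`FP`). [folklore] -/
theorem RF_mem_FP : c.RF ∈ FP := comp_mem_FP (polyFn_mem_FP _) (comp_mem_FP logFn_mem_FP nF_mem_FP)
/-- `NqF` is polynomial-time computable (`FP`). [folklore] -/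
theorem NqF_mem_FP (henc : c.enc ∈ FP) : c.NqF ∈ FP :=
  append_mem_FP (append_mem_FP (lF_mem_FP henc) (lF_mem_FP henc)) (append_mem_FP (append_mem_FP sqF_mem_FP sqF_mem_FP) RF_mem_FP)
/-- `qF` is polynomial-time computable (`FP`). [folklore] -/
theorem qF_mem_FP (henc : c.enc ∈ FP) : c.qF ∈ FP := comp_mem_FP lpgF_mem_FP (NqF_mem_FP henc)
/-- `dF` is polynomial-time computable (`FP`). [folklore] -/
theorem dF_mem_FP (henc : c.enc ∈ FP) : c.dF ∈ FP := comp_mem_FP umulFn_mem_FP (fanoutFn_mem_FP (lF_mem_FP henc) (qF_mem_FP henc))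
/-- `mF` is polynomial-time computable (`FP`). [folklore] -/
theorem mF_mem_FP (henc : c.enc ∈ FP) : c.mF ∈ FP := append_mem_FP SS_mem_FP (append_mem_FP (dF_mem_FP henc) RF_mem_FP)
/-- `VF` is polynomial-time computable (`FP`). [folklore] -/
theorem VF_mem_FP : c.VF ∈ FP := append_mem_FP TT_mem_FP (comp_mem_FP (polyFn_mem_FP _) nF_mem_FP)
/-- `JF` is polynomial-time computable (`FP`). [folklore] -/
theorem JF_mem_FP : c.JF ∈ FP := comp_mem_FP onesFn_mem_FP (comp_mem_FP lenBinF_mem_FP (comp_mem_FP onesFn_mem_FP (comp_mem_FP lenBinF_mem_FP VF_mem_FP)))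
/-- `bigRF` is polynomial-time computable (`FP`). [folklore] -/
theorem bigRF_mem_FP : c.bigRF ∈ FP := comp_mem_FP (polyFn_mem_FP _) VF_mem_FP
/-- `twoJF` is polynomial-time computable (`FP`). [folklore] -/
theorem twoJF_mem_FP : c.twoJF ∈ FP := comp_mem_FP NWRec.pow2F_mem_FP (fanoutFn_mem_FP bigRF_mem_FP JF_mem_FP)
/-- `EF` is polynomial-time computable (`FP`). [folklore] -/
theorem EF_mem_FP : c.EF ∈ FP := append_mem_FP twoJF_mem_FP (append_mem_FP JF_mem_FP (const_mem_FP _))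
/-- `TF` is polynomial-time computable (`FP`). [folklore] -/
theorem TF_mem_FP : c.TF ∈ FP := comp_mem_FP NWRec.pow2F_mem_FP (fanoutFn_mem_FP bigRF_mem_FP EF_mem_FP)
/-- `t1F` is polynomial-time computable (`FP`). [folklore] -/
theorem t1F_mem_FP : c.t1F ∈ FP := comp_mem_FP (polyFn_mem_FP _) (append_mem_FP TF_mem_FP (comp_mem_FP (polyFn_mem_FP _) nF_mem_FP))

end Cfg

end NWPar

end Literature.Computability.MetaComplexity

end
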